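import Literature.NumberTheory.EllipticCurves.AnticyclotomicSignedRelaxedSelmerRankOneReduction
import Literature.NumberTheory.EllipticCurves.HeegnerPointsKolyvaginLocalCriterion
import HarnessLib

/-!
# `ker(loc_𝔭) ⊆ Sel^{str}`: Castella–Wan's `Sel_{str} := ker loc_𝔭` ((6.12)–(6.13)) lies in the tree's
# strict Selmer module `Sel^{str at 𝔭, rel}(K, 𝐓^ac)` (flag `str-vs-loc-zero`, the a-priori direction,
# PROVED), and the named fact `castellaWan2024_proofThm68_selmerRel_le_selmerSgn` (INPUTS row G67) closed
# modulo EXISTING named facts and one saturation input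

`Proofs`-style companion no. 3 of `AnticyclotomicSignedSelmerRelaxedEquality.lean` (INPUTS row G67 of the BSD
cell `pub/bsd-wall/bsd-inputs`; consumer: crux `AnticyclotomicEisensteinDivisibility`,
stmt-BirchSwinnertonDyer-20727, `stub_namedFactsSS` conj. 7), continuing
`AnticyclotomicSignedSelmerRelaxedEqualityReduction.lean` / `AnticyclotomicSignedRelaxedSelmerRankOneReduction.lean`
(same seat, `bsd-input-cw24-lem67-thm68`). THEOREMS ONLY (no definition, no named fact, no instance, no
`sorry`). HONEST FRAMING: the fact is NOT discharged; BSD is not proved by this file.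

## What is proved

The READING flag `str-vs-loc-zero` of `AnticyclotomicSignedMainConjectureTransfer.lean` /
`AnticyclotomicSignedLocalisation.lean` records that Castella–Wan's "`Sel_{str}` = kernel of `loc_𝔮`"
(vanishing in `H¹(K_{n,w}, E[p^m])` at the chosen place `w ∣ 𝔮`, the tree's `locKer`) and the tree's
strict condition `PCond.str` at `𝔮` (every `Γ_K`-conjugate of the image in `H¹(K_∞, E[p^∞])` dies on
`Gal(K̄/K_∞) ⊓ D_𝔮`, `condAboveTorsion … .str`) "agree because `H¹(K_{n,w}, E[p^m]) → H¹(K_{∞,w}, E[p^∞])`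
is injective", the comparison of the compact groups being "not proved here". This file PROVES the
a-priori half `locKer ≤ condAboveTorsion 𝔮 .str` (no injectivity needed): if `loc_𝔮 y = 0` at level
`(n, m)` then so does every conjugate `conj_σ y` (`conjH1_mem_locKer`, one prime of `K_∞` above `𝔮`),
`θ_{n,m}` commutes with `loc` and `conj` (`toInfty_locLevel`, `toInfty_conjH1`), and a class of
`H¹(K_∞, E[p^∞])` killed by `loc` (restriction ALONG `Γ_{K_𝔮} → Γ_K` followed by `E[p^∞](K̄) →
E[p^∞](K̄_𝔮)`) dies on `Gal(K̄/K_∞) ⊓ D_𝔮` (restriction TO the image `D_𝔮` of `Γ_{K_𝔮}`), because the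
torsion points over `K̄_𝔮` all come from `K̄` (`torsionPointsMap_bijective`, Silverman III.6.4) — §1–§3.
Hence (§4) a family `x ∈ Sel^{𝓛}(K, 𝐓^ac)` with `loc_𝔮 x = 0` lies in `Sel^{str at 𝔮, rel}(K, 𝐓^ac)`
(`PCond.at 𝔮 .str .rel`), and (§5) if that module is `Λ`-torsion (`selmerLambdaAdic.IsTorsion`, the
currency of the EXISTING named fact `castellaWan2024_thmA5_thm68_bdp_mem_charIdeal`, Thm. 6.8 (ii):
"`Sel^{str,rel}(K, 𝐓^ac)` [is] `Λ^ac`-torsion") then every element of `ker(loc_𝔮 | Sel^{𝓛})` is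
`Λ`-torsion — the hypothesis `hStrRel` of
`castellaWan2024_proofThm68_selmerRel_le_selmerSgn_of_torsion_locKer_of_saturated`. §6 assembles: the named
fact G67 follows from `IsNonsplitIn κ 𝔭`, `Squarefree N` (a binder of the Thm. A.5 fact) and the three
EXISTING named facts `iovitaPollack2006_lemma21_noPTorsion_top` (proved in the tree, Summit side),
`castellaWan2024_thmA5_thm68_bdp_mem_charIdeal` (Thm. A.5 ⟹ Thm. 6.8 (ii)), 
`castellaWan2024_sec61_localSignedLambdaAdic_free_rank_one` (§6.1 / Prop. 3.11), plus ONE input that is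
not a named fact of the tree: the saturation of `Sel_ε` in `Sel^{ε,rel}` (Prop. 3.8 at `𝔭̄`: "the quotient
… injects into `H¹(K_𝔭̄, 𝐓^ac)/H¹_±(K_𝔭̄, 𝐓^ac)`, which has trivial `Λ^ac`-torsion").

## Contents

* §1 `primaryTorsionMapOfEmb_closureEmb_surjective`: `E[p^∞](K̄) → E_{K'}[p^∞](K̄_{K'})` along the chosen
  embedding is onto (`K'/K` any field of characteristic `0`; Silverman III.6.4 (b) via the tree's
  `torsionPointsMap_bijective`).
* §2 `mem_awayKer_of_locInfty_eq_zero`: `loc c = 0 ⟹ c ∈ awayKer (Gal(K̄/K_∞)) E[p^∞] v`.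
* §3 `mem_condAboveTorsion_str_of_mem_locKer`: `locKer … v n m ≤ condAboveTorsion … v .str n m`.
* §4 `mem_selmerLambdaAdic_at_str_rel_of_locAt_eq_zero`: `x ∈ Sel^{𝓛}(K, 𝐓^ac)`, `loc_v x = 0` ⟹
  `x ∈ Sel^{str at v, rel}(K, 𝐓^ac)`.
* §5 `exists_smul_eq_zero_of_locSignedAt_eq_zero_of_isTorsion`: … and if `Sel^{str at v, rel}` is
  `Λ`-torsion then `x` is a `Λ`-torsion element of `Sel^{𝓛}` (structures `selmerLambdaAdic.moduleOfGen`).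
* §6 `castellaWan2024_proofThm68_selmerRel_le_selmerSgn_of_thmA5_of_saturated`: INPUTS row G67 from the
  existing named facts + saturation.

References: [CastellaWan2023] (6.12)–(6.13) and proof of Thm. 6.8 (MS p. 30), Thm. 6.8 (ii), Def. 5.1
(MS p. 23); [Greenberg1989] §1 p. 98 (strict condition = dying on `D_v`); [SilvermanAEC2009] III.6.4 (b),
VIII.§2 (restriction to the decomposition group); [NeukirchANT1999] II.(9.6) (`D_v` = image of `Γ_{K_v}`).
-/

noncomputable section

open scoped Classical

open PowerSeries NumberField IsDedekindDomain Field
open Literature.NumberTheory.EllipticCurves Literature.NumberTheory.GaloisRepresentations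
open Literature.NumberTheory.EllipticCurves.ModularForms Literature.NumberTheory.EllipticCurves.Castella2018
open Literature.NumberTheory.EllipticCurves.GreenbergSelmer
open Literature.NumberTheory.EllipticCurves.CocycleCriteria
open Literature.NumberTheory.EllipticCurves.BigGaloisRep
open WeierstrassCurve (geomTorsion geomPoints)

universe u

namespace Literature.NumberTheory.EllipticCurves.AcSigned

/-! ## §1 Torsion points over `K̄_{K'}` come from `K̄` -/

section Torsion

variable {K : Type u} [Field K] [NumberField K] (W : WeierstrassCurve K) (p : ℕ) [Fact p.Prime]

/-- **`E[p^∞](K̄) → E_{K'}[p^∞](K̄_{K'})` along the chosen embedding `K̄ → K̄_{K'}` is surjective** for an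
elliptic curve `E = W` over a number field `K` and any `K`-field `K'` of characteristic `0` (a completion
`K_v`): a `p^k`-torsion point over `K̄_{K'}` is one of the `p^{2k}` points `E[p^k](K̄)` (the tree's
`torsionPointsMap_bijective`, Silverman III.6.4 (b)), transported to the base-changed curve by
`localPointsEquivBaseChange`. [cite: SilvermanAEC2009, Cor. III.6.4 (b) and VIII.§1] -/
theorem primaryTorsionMapOfEmb_closureEmb_surjective [W.IsElliptic] (K' : Type u) [Field K'] [Algebra K K']
    [CharZero K'] :
    Function.Surjective (primaryTorsionMapOfEmb W p (closureEmb (K := K) K')) := by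
  intro t
  obtain ⟨k, hk⟩ := (AddCommGroup.mem_primaryComponent (G := geomPoints (W.baseChange K')) (p := p)).mp t.2
  -- pull `t` back to the `Sha`-model `E(K̄_{K'})` of the local points (the identity on coordinates)
  set u : localPoints W K' := W.geomPointsToLocalPoints (E := K') (t : geomPoints (W.baseChange K'))
    with hu
  have hut : W.localPointsToGeomPoints (E := K') u = (t : geomPoints (W.baseChange K')) := by
    rw [hu, WeierstrassCurve.localPointsToGeomPoints_geomPointsToLocalPoints]
  have hu' : u ∈ AddSubgroup.torsionBy (localPoints W K') ((p ^ k : ℕ) : ℤ) := by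
    rw [AddSubgroup.torsionBy, Submodule.mem_toAddSubgroup, Submodule.mem_torsionBy_iff]
    change ((p ^ k : ℕ) : ℤ) • u = 0
    apply W.localPointsToGeomPoints_injective (E := K')
    rw [natCast_zsmul, map_nsmul, hut, hk, map_zero]
  obtain ⟨P, hP⟩ :=
    (torsionPointsMap_bijective W K' (pow_ne_zero k (Fact.out : p.Prime).ne_zero)).2 ⟨u, hu'⟩
  have hPmem : (P : geomPoints W) ∈ W.geomPrimaryTorsion p := by
    refine (AddCommGroup.mem_primaryComponent (G := geomPoints W) (p := p)).mpr ⟨k, ?_⟩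
    have h := (WeierstrassCurve.mem_geomTorsion_iff W _ (P : geomPoints W)).mp P.2
    rwa [natCast_zsmul] at h
  refine ⟨⟨P, hPmem⟩, Subtype.ext ?_⟩
  have hPu : pointsMapOfEmb W (closureEmb (K := K) K') (P : geomPoints W) = u := by
    have h := congrArg Subtype.val hP
    rw [coe_torsionPointsMap] at h
    exact h
  rw [coe_primaryTorsionMapOfEmb, WeierstrassCurve.geomPointsMapOfEmb_apply, hPu, hut]

omit [NumberField K] [Fact p.Prime] in
/-- `E[p^∞](K̄) → E_{K'}[p^∞](K̄_{K'})` along any `K`-embedding is injective (`geomPointsMapOfEmb_injective`).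
[cite: SilvermanAEC2009, III.§7 and VIII.§1] -/
theorem primaryTorsionMapOfEmb_injective {K' : Type u} [Field K'] [Algebra K K']
    (ι : AlgebraicClosure K →ₐ[K] AlgebraicClosure K') :
    Function.Injective (primaryTorsionMapOfEmb W p ι) := by
  intro a b h
  apply Subtype.ext
  apply WeierstrassCurve.geomPointsMapOfEmb_injective W ι
  have h' := congrArg Subtype.val h
  rw [coe_primaryTorsionMapOfEmb, coe_primaryTorsionMapOfEmb] at h'
  exact h'

end Torsion

/-! ## §2 `loc c = 0` on `H¹(K_∞, E[p^∞])` ⟹ `c` dies on `Gal(K̄/K_∞) ⊓ D_v` -/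

section LocInfty

variable {K : Type u} [Field K] [NumberField K] (W : WeierstrassCurve K) (p : ℕ) [Fact p.Prime]
  (κ : ZpExtension K p)

/-- **`loc_v c = 0 ⟹ c ∈ awayKer`**: if a class `c ∈ H¹(K_∞, E[p^∞])` is killed by `loc` (restriction along
`Gal(K̄_v/K_∞·K_v) → Gal(K̄/K_∞)` followed by `E[p^∞](K̄) → E[p^∞](K̄_v)`, `locInfty` at the chosen
embedding), then it dies on `Gal(K̄/K_∞) ⊓ D_v` (`awayKer`, `D_v` the image of `Γ_{K_v}`): on cocycles,
`ι(φ(τ|)) = τ t' − t'` for a torsion point `t'` over `K̄_v`, which is `ι(t)` (§1), and `ι` is injective.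
[cite: SilvermanAEC2009, VIII.§2 and Cor. III.6.4 (b)] [cite: NeukirchANT1999, Ch. II §9 Prop. (9.6)] -/
theorem mem_awayKer_of_locInfty_eq_zero [W.IsElliptic] (v : HeightOneSpectrum (𝓞 K)) (hv : IsNonsplitIn κ v)
    {c : W.subgroupH1 p κ.kerSubgroup}
    (hc : locInfty W p κ (closureEmb (K := K) (v.adicCompletion K)) hv c = 0) :
    c ∈ awayKer κ.kerSubgroup (W.geomPrimaryTorsion p) v := by
  haveI : CharZero (v.adicCompletion K) :=
    charZero_of_injective_algebraMap (algebraMap K (v.adicCompletion K)).injective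
  obtain ⟨φ, rfl⟩ := oneCocycleClass_surjective (discreteTopRep κ.kerSubgroup (W.geomPrimaryTorsion p)) c
  rw [locInfty, resH1Hom_oneCocycleClass_eq_zero_iff] at hc
  obtain ⟨t', ht'⟩ := hc
  obtain ⟨t, rfl⟩ := primaryTorsionMapOfEmb_closureEmb_surjective W p (v.adicCompletion K) t'
  change resOfLe (W.geomPrimaryTorsion p) (inf_le_left : κ.kerSubgroup ⊓ decomp v ≤ κ.kerSubgroup)
      (oneCocycleClass (discreteTopRep κ.kerSubgroup (W.geomPrimaryTorsion p)) φ) = 0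
  rw [resOfLe_oneCocycleClass_eq_zero_iff]
  refine ⟨t, fun x ↦ ?_⟩
  obtain ⟨τ, hτ⟩ := (mem_decomp_iff v _).1 (Subgroup.mem_inf.1 x.2).2
  -- `resGalOfEmb (closureEmb K_v) τ = x` is `hτ` (`absGaloisRestrict K K_v = resGalOfEmb (closureEmb K_v)`)
  have hτ' : resGalOfEmb (closureEmb (K := K) (v.adicCompletion K)) τ = (x : absoluteGaloisGroup K) := hτ
  have hτH : τ ∈ (localizeAt κ v hv).kerSubgroup := by
    change resGalOfEmb (closureEmb (K := K) (v.adicCompletion K)) τ ∈ κ.kerSubgroup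
    rw [hτ']
    exact (Subgroup.mem_inf.1 x.2).1
  -- compare in the geometric points of the local curve, where `ι_*` is injective and equivariant
  have h1 := congrArg Subtype.val (ht' ⟨τ, hτH⟩)
  simp only [AddSubgroupClass.coe_sub, primaryComponent.coe_smul, coe_primaryTorsionMapOfEmb] at h1
  have h4 : (⟨τ, hτH⟩ : (localizeAt κ v hv).kerSubgroup) •
      W.geomPointsMapOfEmb (closureEmb (K := K) (v.adicCompletion K)) (t : geomPoints W) =
      τ • W.geomPointsMapOfEmb (closureEmb (K := K) (v.adicCompletion K)) (t : geomPoints W) := rfl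
  rw [h4, ← WeierstrassCurve.geomPointsMapOfEmb_smul W _ τ, ← map_sub] at h1
  have h2 := WeierstrassCurve.geomPointsMapOfEmb_injective W _ h1
  -- `h2 : (φ (τ|) : E(K̄)) = τ| • t - t`
  have hincl : Subgroup.inclusion (inf_le_left : κ.kerSubgroup ⊓ decomp v ≤ κ.kerSubgroup) x =
      resGalSubgroupOfEmb κ.kerSubgroup (closureEmb (K := K) (v.adicCompletion K)) ⟨τ, hτH⟩ :=
    Subtype.ext hτ.symm
  apply Subtype.ext
  simp only [AddSubgroupClass.coe_sub, primaryComponent.coe_smul]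
  rw [hincl, ← hτ']
  -- (`⟨τ, hτH⟩` is read in `Gal(K̄_v/K_∞·K_v)` presented either as `(κ_v).kerSubgroup` or as
  -- `localSubgroupOfEmb`, two definitionally equal subgroups)
  exact h2

end LocInfty

/-! ## §3 `locKer ≤ condAboveTorsion v .str` (flag `str-vs-loc-zero`, the a-priori direction) -/

section LocKer

variable {K : Type u} [Field K] [NumberField K] (W : WeierstrassCurve K) (p : ℕ) [Fact p.Prime]
  (κ : ZpExtension K p)

/-- **Castella–Wan's `Sel_{str} = ker loc_𝔮` implies the tree's strict condition at `𝔮`, levelwise.** If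
`y ∈ H¹(K_n, E[p^m])` is killed by `loc_v` at the chosen place above `v` (`locKer`, one prime of `K_∞`
above `v`), then every `Γ_K`-conjugate of `θ_{n,m}(y) ∈ H¹(K_∞, E[p^∞])` dies on `Gal(K̄/K_∞) ⊓ D_v`, i.e.
`y ∈ condAboveTorsion … v .str n m`: `conj_σ y ∈ locKer` (`conjH1_mem_locKer`), `θ` commutes with `conj`
and `loc` (`toInfty_conjH1`, `toInfty_locLevel`), §2, and Greenberg's strict condition for Castella's datum
`M⁺_v = 0` is `awayKer` (`strictKer_strictDatum_eq_awayKer`).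
[cite: CastellaWan2023, (6.12)–(6.13) (MS p. 30) and Def. 5.1 (MS p. 23)] [cite: Greenberg1989, §1 p. 98] -/
theorem mem_condAboveTorsion_str_of_mem_locKer [W.IsElliptic] (v : HeightOneSpectrum (𝓞 K))
    (hv : IsNonsplitIn κ v) (n m : ℕ) {y : W.torsionH1Over ((p : ℤ) ^ m) (κ.layerSubgroup n)}
    (hy : y ∈ locKer W p κ (closureEmb (K := K) (v.adicCompletion K)) hv n m) :
    y ∈ condAboveTorsion W p κ v .str n m := by
  rw [mem_condAboveTorsion_iff, mem_condAbove_str_iff]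
  intro σ
  rw [strictKer_strictDatum_eq_awayKer, ← toInfty_conjH1]
  refine mem_awayKer_of_locInfty_eq_zero W p κ v hv ?_
  rw [← toInfty_locLevel, (mem_locKer_iff W p κ _ hv n m _).1
    (conjH1_mem_locKer W p κ _ hv n m σ hy), map_zero]

/-! ## §4 `ker(loc_v | Sel^{𝓛}(K, 𝐓^ac)) ⊆ Sel^{str at v, rel}(K, 𝐓^ac)` -/

/-- **`ker(loc_v | Sel^{𝓛}(K, 𝐓^ac)) ⊆ Sel^{str at v, rel}(K, 𝐓^ac)`**: a norm-compatible family
`x ∈ Sel^{𝓛}(K, 𝐓^ac)` killed by `loc_v` (`locAt`, equivalently `locSignedAt` when `𝓛_v = ε`) satisfies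
the tree's strict condition at `v` at every level (§3) and, trivially, the relaxed condition at the other
primes above `p`; the conditions away from `p` and the two compatibilities are those of `x`. So
Castella–Wan's `Sel^{str,rel}(K, 𝐓^ac) = ker(loc_𝔭 | Sel^{±,rel})` of (6.12) lies in the tree's
`selmerLambdaAdic … (PCond.at 𝔭 .str .rel)`. [cite: CastellaWan2023, (6.12)–(6.13) and Def. 5.1 (MS pp. 23, 30)] -/
theorem mem_selmerLambdaAdic_at_str_rel_of_locAt_eq_zero [W.IsElliptic] (v : HeightOneSpectrum (𝓞 K))
    (hv : IsNonsplitIn κ v) {γ : absoluteGaloisGroup K} {γv : absoluteGaloisGroup (v.adicCompletion K)}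
    (hγv : κ (resGalOfEmb (closureEmb (K := K) (v.adicCompletion K)) γv) = κ γ)
    {L : HeightOneSpectrum (𝓞 K) → PCond} (x : selmerLambdaAdic W p κ γ L)
    (hx : locAt W p κ v hv γ γv hγv L x = 0) :
    x.1 ∈ selmerLambdaAdic W p κ γ (PCond.at v .str .rel) := by
  have hker := (locAt_eq_zero_iff W p κ v hv hγv L x).1 hx
  have hx2 := (mem_lambdaAdic_iff (C := fun n m ↦ selmerTorsion W p κ L n m) x.1).1 x.2
  refine (mem_lambdaAdic_iff (C := fun n m ↦ selmerTorsion W p κ (PCond.at v .str .rel) n m) x.1).2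
    ⟨fun n m ↦ ?_, hx2.2.1, hx2.2.2⟩
  rw [mem_selmerTorsion_iff]
  refine ⟨((mem_selmerTorsion_iff _).1 (hx2.1 n m)).1, fun w _ ↦ ?_⟩
  by_cases hwv : w = v
  · subst hwv
    rw [PCond.at_self]
    exact mem_condAboveTorsion_str_of_mem_locKer W p κ w hv n m (hker n m)
  · rw [PCond.at_of_ne _ _ hwv, condAboveTorsion_rel]
    exact AddSubgroup.mem_top _

/-! ## §5 If `Sel^{str at v, rel}(K, 𝐓^ac)` is `Λ`-torsion, `ker(loc_v)` consists of torsion elements -/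

/-- **"`Sel^{str,rel}(K, 𝐓^ac)` is `Λ^ac`-torsion" ⟹ every element of `ker(loc_v | Sel^{𝓛})` is
`Λ`-torsion**, for the constructed structures `selmerLambdaAdic.moduleOfGen hγ` (the same truncated
action `tsmul` on both carriers): the family of `x` IS an element of `Sel^{str at v, rel}` (§4), a
non-zero-divisor `a` kills it there, and `(a • x)` has the same underlying family. This is the hypothesis
`hStrRel`/`hker` of `finrank_selmerLambdaAdic_eq_one_of_torsion_locKer` from the torsion statement in the
currency `selmerLambdaAdic.IsTorsion … (PCond.at v .str .rel)` of Thm. 6.8 (ii) (named fact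
`castellaWan2024_thmA5_thm68_bdp_mem_charIdeal`). [cite: CastellaWan2023, Thm. 6.8 (ii) and its proof, (6.12) (MS p. 30)] -/
theorem exists_smul_eq_zero_of_locAt_eq_zero_of_isTorsion [W.IsElliptic] (v : HeightOneSpectrum (𝓞 K))
    (hv : IsNonsplitIn κ v) {γ : absoluteGaloisGroup K} (hγ : κ.IsTopGenerator γ)
    {γv : absoluteGaloisGroup (v.adicCompletion K)}
    (hγv : κ (resGalOfEmb (closureEmb (K := K) (v.adicCompletion K)) γv) = κ γ)
    {L : HeightOneSpectrum (𝓞 K) → PCond}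
    (hT : selmerLambdaAdic.IsTorsion W p κ γ hγ (PCond.at v .str .rel))
    (x : selmerLambdaAdic W p κ γ L) (hx : locAt W p κ v hv γ γv hγv L x = 0) :
    ∃ g : IwasawaAlgebra p, g ≠ 0 ∧ (letI := selmerLambdaAdic.moduleOfGen W p κ γ hγ L; g • x) = 0 := by
  letI instL := selmerLambdaAdic.moduleOfGen W p κ γ hγ L
  letI instS := selmerLambdaAdic.moduleOfGen W p κ γ hγ (PCond.at v .str .rel)
  have hmem := mem_selmerLambdaAdic_at_str_rel_of_locAt_eq_zero W p κ v hv hγv x hx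
  obtain ⟨⟨a, ha⟩, hax⟩ := @hT ⟨x.1, hmem⟩
  refine ⟨a, nonZeroDivisors.ne_zero ha, ?_⟩
  -- both actions are the truncated action `tsmul` on the common underlying family (definitional)
  have h1 : (a • (⟨x.1, hmem⟩ : selmerLambdaAdic W p κ γ (PCond.at v .str .rel))).1 =
      tsmul W p κ γ a x.1 := rfl
  have h2 : (a • x).1 = tsmul W p κ γ a x.1 := rfl
  have hax' : a • (⟨x.1, hmem⟩ : selmerLambdaAdic W p κ γ (PCond.at v .str .rel)) = 0 := hax
  apply Subtype.ext
  rw [h2, ← h1, hax', ZeroMemClass.coe_zero, ZeroMemClass.coe_zero]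

/-- The same with `loc_v` read in the local SIGNED module (`locSignedAt`, `𝓛_v = ε`): its kernel is that
of `locAt` (same underlying family, `coe_locSignedAt`). [cite: CastellaWan2023, (6.12) (MS p. 30)] -/
theorem exists_smul_eq_zero_of_locSignedAt_eq_zero_of_isTorsion [W.IsElliptic]
    (v : HeightOneSpectrum (𝓞 K)) (hv : IsNonsplitIn κ v) {γ : absoluteGaloisGroup K}
    (hγ : κ.IsTopGenerator γ) {γv : absoluteGaloisGroup (v.adicCompletion K)}
    (hγv : κ (resGalOfEmb (closureEmb (K := K) (v.adicCompletion K)) γv) = κ γ)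
    {L : HeightOneSpectrum (𝓞 K) → PCond} {ε : ℤˣ} (hL : L v = .sgn ε)
    (hvp : ((p : ℕ) : 𝓞 K) ∈ v.asIdeal)
    (hT : selmerLambdaAdic.IsTorsion W p κ γ hγ (PCond.at v .str .rel))
    (x : selmerLambdaAdic W p κ γ L) (hx : locSignedAt W p κ v hv γ γv hγv L ε hL hvp x = 0) :
    ∃ g : IwasawaAlgebra p, g ≠ 0 ∧ (letI := selmerLambdaAdic.moduleOfGen W p κ γ hγ L; g • x) = 0 := by
  refine exists_smul_eq_zero_of_locAt_eq_zero_of_isTorsion W p κ v hv hγ hγv hT x (Subtype.ext ?_)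
  have h := congrArg Subtype.val hx
  rw [coe_locSignedAt] at h
  rw [h, ZeroMemClass.coe_zero, ZeroMemClass.coe_zero]

end LocKer

/-! ## §6 INPUTS row G67 from EXISTING named facts and one saturation input -/

section Fact

variable {N : ℕ} [NeZero N] {W : WeierstrassCurve ℚ} [W.IsGloballyMinimal] {K : Type} [Field K]
  [NumberField K] {p : ℕ} [Fact p.Prime] {κ : ZpExtension K p} {𝔭 𝔭' : HeightOneSpectrum (𝓞 K)}

/-- **Castella–Wan's sentence "`Sel_±(K, 𝐓^ac) = Sel^{±,rel}(K, 𝐓^ac)`" (proof of Thm. 6.8, MS p. 30) — the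
named fact `castellaWan2024_proofThm68_selmerRel_le_selmerSgn` (INPUTS row G67) — from EXISTING named facts
of the tree and ONE remaining input**, third reduction (after
`castellaWan2024_proofThm68_selmerRel_le_selmerSgn_of_rankOne_of_saturated` and
`castellaWan2024_proofThm68_selmerRel_le_selmerSgn_of_torsion_locKer_of_saturated`). Hypotheses:
* `h𝔭 : IsNonsplitIn κ 𝔭` (one prime of `K_∞` above `𝔭`; true in the `Setting`, flag `localize-nonsplit`) and
  `hsq : Squarefree N` (a binder of the Thm. A.5 fact below, Castella–Wan Thm. A.5 / [CGLS22]);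
* `hE : iovitaPollack2006_lemma21_noPTorsion_top …` — `E(K_∞)[p] = 0` (named fact, PROVED in the tree on the
  Summit side) ⟹ [PR00, §1.3.3] torsion-freeness of `Sel^{ε,rel}` (`selmerLambdaAdic.smul_eq_zero_imp_of_layers`);
* `hA5 : castellaWan2024_thmA5_thm68_bdp_mem_charIdeal …` — Thm. A.5 ⟹ Thm. 6.8 (ii); ONLY its first conjunct
  "`Sel^{str,rel}(K, 𝐓^ac)` is `Λ^ac`-torsion" (`selmerLambdaAdic.IsTorsion … (PCond.at 𝔭 .str .rel)`) is used,
  through §5 (`ker loc_𝔭 ⊆ Sel^{str,rel}`, this file) and the rank count of (6.12)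
  (`finrank_selmerLambdaAdic_eq_one_of_torsion_locKer`);
* `hH : castellaWan2024_sec61_localSignedLambdaAdic_free_rank_one …` — "`H¹_±(K_𝔭, 𝐓^ac) ≃ Λ^ac`";
* `hC` — the saturation of `Sel_ε` in `Sel^{ε, rel at 𝔭'}` ("the quotient … injects into
  `H¹(K_𝔭̄, 𝐓^ac)/H¹_±(K_𝔭̄, 𝐓^ac)`, which has trivial `Λ^ac`-torsion by Proposition 3.8"), the ONE input that is
  not a named fact of the tree (it needs the local module `H¹(K_𝔭̄, 𝐓^ac)/H¹_±` of Prop. 3.8, absent).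
So INPUTS row G67 is closed MODULO `hC` and the named facts G-rows of `hA5`, `hH` (and the proved `hE`); no
new definition or named fact is introduced; BSD is not proved by this.
[cite: CastellaWan2023, proof of Thm. 6.8, (6.12), Thm. 6.8 (ii) (MS p. 30); Prop. 3.8, Prop. 3.11 (MS p. 15); §6.1 (MS p. 25); Thm. A.5 (MS p. 35)]
[cite: IovitaPollack2006, Lemma 2.1 (arXiv:math/0411496 p. 5)]
[cite: PerrinRiou1995Asterisque, §1.3.3 (cited through CastellaWan2023, MS p. 30)] -/
theorem castellaWan2024_proofThm68_selmerRel_le_selmerSgn_of_thmA5_of_saturated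
    (h𝔭 : IsNonsplitIn κ 𝔭) (hsq : Squarefree N)
    (hE : iovitaPollack2006_lemma21_noPTorsion_top W K p κ 𝔭 𝔭')
    (hA5 : castellaWan2024_thmA5_thm68_bdp_mem_charIdeal N W K p κ 𝔭 𝔭')
    (hH : castellaWan2024_sec61_localSignedLambdaAdic_free_rank_one W K p κ 𝔭 𝔭')
    (hC : ∀ (_ : Setting W K p κ 𝔭 𝔭') (ι : PadicAlgCl p ≃+* ℂ) {f : CuspForm (CongruenceSubgroup.Gamma0 N) 2}
      (_ : IsNewformOf W f), (W.conductorNorm ℤ : ℕ) = N → SatisfiesHeegnerHypothesis N K → 3 < p →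
      (∀ (w : InfinitePlace K) (k : 𝓞 K), k ∈ 𝔭.asIdeal ↔ ‖ι.symm (w.embedding (k : K))‖ < 1) →
      ∀ (γ : absoluteGaloisGroup K) (hγ : κ.IsTopGenerator γ) (ε : ℤˣ),
        (letI := selmerLambdaAdic.moduleOfGen (W.baseChange K) p κ γ hγ (fun _ ↦ PCond.sgn ε)
         Module.finrank (IwasawaAlgebra p) (selmerLambdaAdic (W.baseChange K) p κ γ (fun _ ↦ .sgn ε)) = 1) →
        X.HasRank (W.baseChange K) p κ ∅ (fun _ ↦ .sgn ε) hγ 1 →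
        ∀ (g : IwasawaAlgebra p), g ≠ 0 →
          ∀ x : selmerLambdaAdic (W.baseChange K) p κ γ (PCond.at 𝔭' .rel (.sgn ε)),
            (letI := selmerLambdaAdic.moduleOfGen (W.baseChange K) p κ γ hγ (PCond.at 𝔭' .rel (.sgn ε))
             (g • x).1) ∈ selmerLambdaAdic (W.baseChange K) p κ γ (fun _ ↦ .sgn ε) →
            x.1 ∈ selmerLambdaAdic (W.baseChange K) p κ γ (fun _ ↦ .sgn ε)) :
    castellaWan2024_proofThm68_selmerRel_le_selmerSgn N W K p κ 𝔭 𝔭' := by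
  refine castellaWan2024_proofThm68_selmerRel_le_selmerSgn_of_torsion_locKer_of_saturated h𝔭 hE ?_ hH hC
  intro hS ι f hf hN hHeeg hp hι γ hγ ε _ _ γ𝔭 hγ𝔭 x hx
  haveI : Fact (κ.IsTopGenerator γ) := ⟨hγ⟩
  haveI := hS.isElliptic
  haveI : (W.baseChange K).IsElliptic := by rw [WeierstrassCurve.baseChange]; infer_instance
  have hT := (hA5 hS ι hf hN hHeeg hp hsq hι γ).1
  exact exists_smul_eq_zero_of_locSignedAt_eq_zero_of_isTorsion (W.baseChange K) p κ 𝔭 h𝔭 hγ hγ𝔭 _ hS.mem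
    hT x hx

end Fact

end Literature.NumberTheory.EllipticCurves.AcSigned

end
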